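import Literature.Geometry.Lorentzian.KerrIngoingCoordRiemann
import Literature.Geometry.Lorentzian.KerrIngoingCoordRiemannII
import Literature.Geometry.Lorentzian.KerrIngoingCoordRiemannIII
import HarnessLib

/-!
# The Kerr metric in ingoing Kerr coordinates: the COORDINATE Ricci form `ricAt` vanishes

A bridge inside the tree's Kerr infrastructure. `KerrIngoingCoordRicci(Flat).lean` prove `Ric = 0`
for every smooth metric `g'` on an open chart whose components are the rational Kerr components
`Kerr.Ingoing.bilin M a` (manifold-level statement, `Kerr.Ingoing.ricci_eq_zero_of_repr`, and the
discharge `Kerr.isRicciFlat_holds`). The rank-generic coordinate tensor calculus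
(`CoordTensorCalculus`, `CoordDeformationWave`, …) instead speaks of the pure coordinate Ricci form
`MetricCoord.ricAt G x` of a component field `G`. This file records the coordinate statement
directly: **`Kerr.Ingoing.ricAt_bilin_eq_zero`** — `ricAt (Kerr.Ingoing.bilin M a) u = 0` at every
point of the regular set `{Σ ≠ 0, μ² ≠ 1}`, for all real `M, a` (no smallness of the spin). Proof:
`Ric(∂_k, ∂_l) = Σ_i (R(∂_i, ∂_k)∂_l)^i` (O'Neill 1983, Ch. 3, Lemma 3.52, `MetricCoord.ricAt_eq_sum_coord`)
with the tree's closed-form curvature endomorphisms `Kerr.Ingoing.riem_AC` (`KerrIngoingCoordRiemann*.lean`),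
sixteen rational identities checked by `field_simp`/`ring`; then bilinearity. Everything is proved;
no definition of `Prop` type. Consumer: `KerrZeroEnergyGaugePotential.lean` (Hintz's gauge potential
wave operator `2δ𝖦δ^* = −(□ + Ric)` on 1-forms).

## References

* R. P. Kerr, Phys. Rev. Lett. 11 (1963) 237–238; R. P. Kerr, A. Schild (1965), §3. [KerrSchild1965]
* B. O'Neill, *Semi-Riemannian geometry*, 1983, Ch. 3, Lemma 3.38, Lemma 3.52. [ONeill1983]
-/

noncomputable section

set_option maxSynthPendingDepth 3

open Set Function Module
open scoped ContDiff Topology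
open Literature.Geometry.Lorentzian.MetricCoord

namespace Literature.Geometry.Lorentzian

namespace Kerr

namespace Ingoing

variable (M a : ℝ) {u : E4}

set_option maxHeartbeats 2000000 in
/-- **The coordinate Ricci form of the Kerr components vanishes on coordinate vectors**:
`ricAt (bilin M a) u (∂_k, ∂_l) = 0` for `u` in the regular set, all `k, l`, all real `M, a`
(`Ric(∂_k,∂_l) = Σ_i (R(∂_i,∂_k)∂_l)^i` with the closed-form `R(∂_A,∂_C)` of
`KerrIngoingCoordRiemann*.lean`). [cite: KerrSchild1965, §3] -/
theorem ricAt_bilin_bv (hu : u ∈ regularSet a) (k l : Fin 4) :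
    ricAt (bilin M a) u (E4.basisVector k) (E4.basisVector l) = 0 := by
  have hS := hu.1
  have hP := hu.2
  rw [ricAt_eq_sum_coord (EuclideanSpace.basisFun (Fin 4) ℝ).toBasis, Fin.sum_univ_four]
  simp only [basisFun_toBasis_apply, basisFun_toBasis_coord]
  fin_cases k <;> fin_cases l <;> simp only [Fin.zero_eta, Fin.mk_one, Fin.reduceFinMk, Fin.isValue,
    riemAt_self, riemAt_swap (bilin M a) u (E4.basisVector 0) (E4.basisVector 1),
    riemAt_swap (bilin M a) u (E4.basisVector 0) (E4.basisVector 2),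
    riemAt_swap (bilin M a) u (E4.basisVector 0) (E4.basisVector 3),
    riemAt_swap (bilin M a) u (E4.basisVector 1) (E4.basisVector 2),
    riemAt_swap (bilin M a) u (E4.basisVector 1) (E4.basisVector 3),
    riemAt_swap (bilin M a) u (E4.basisVector 2) (E4.basisVector 3),
    riem_01 M a hu, riem_02 M a hu, riem_03 M a hu, riem_12 M a hu, riem_13 M a hu, riem_23 M a hu,
    neg_apply, zero_apply, WithLp.ofLp_neg, WithLp.ofLp_zero,
    Pi.neg_apply, Pi.zero_apply, sum_smul_basisVector_apply,
    Matrix.of_apply, Matrix.cons_val', Matrix.cons_val_zero, Matrix.cons_val_one, Matrix.cons_val,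
    Matrix.empty_val', Matrix.cons_val_fin_one, neg_zero, add_zero, zero_add] <;>
    field_simp <;> simp only [sigma, sinSq] at hS hP ⊢ <;> ring

/-- **`Ric = 0` for the Kerr components, coordinate form**: the coordinate Ricci form
`MetricCoord.ricAt (Kerr.Ingoing.bilin M a) u` is the zero bilinear form at every point of the
regular set `{Σ ≠ 0, μ² ≠ 1}`, for all real `M, a` — the `MetricCoord`-level companion of
`Kerr.Ingoing.ricci_eq_zero_of_repr`. [cite: KerrSchild1965, §3] -/
theorem ricAt_bilin_eq_zero (hu : u ∈ regularSet a) : ricAt (bilin M a) u = 0 := by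
  ext Y Z
  rw [eq_sum_basisVector Y, eq_sum_basisVector Z]
  simp [map_sum, map_smul, ricAt_bilin_bv M a hu]

end Ingoing

end Kerr

end Literature.Geometry.Lorentzian

end
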